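import Summits.Ventures.PercRepro.RankDistTightULC

/-!
# PercRepro — the cumulative shadow inequality split into its independent and dependent parts (p9, gen 19)

With `s_u = i_u + d_u` (`RankDistTightSymm`: `i_u` = the independent shadow sets of rank `u` — on the tight layer the
bipartitions of `E` into two independent sets —, `d_u` = the dependent ones), the two statements
`IndepShadowCumulative M p q : i_q·C(p+q, u) ≤ i_u·C(p+q, q)` and `DepShadowCumulative M p q : d_q·C(p+q, u) ≤
d_u·C(p+q, q)` (for every `q < u < p`) together give `ShadowCumulative M p q` (`shadowCumulative_of_split`). Both
parts held on every tight-layer cell of the g19 censuses (j298622: 244,041 / 244,041 each); the independent part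
follows from its ultra-log-concavity (`indepShadow_cumulative_of_ulc`, `RankDistTightULC`). Typed here so that each
part can be attacked or refuted by name. Nothing here is a statement about any window of the crux.
-/

namespace PercRepro.RankDist

open Set Finset _root_.Matroid PercRepro.ThmH

variable {α : Type} [DecidableEq α] (M : Matroid α) [M.Finite]

/-- **The cumulative inequality for the INDEPENDENT shadow**: `i_q·C(p+q, u) ≤ i_u·C(p+q, q)` for `q < u < p`. -/
def IndepShadowCumulative (p q : ℕ) : Prop :=
  ∀ u, q < u → u < p →
    (indepShadow M p q q).card * (p + q).choose u ≤ (indepShadow M p q u).card * (p + q).choose q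

/-- **The cumulative inequality for the DEPENDENT shadow**: `d_q·C(p+q, u) ≤ d_u·C(p+q, q)` for `q < u < p`. -/
def DepShadowCumulative (p q : ℕ) : Prop :=
  ∀ u, q < u → u < p →
    (depShadow M p q q).card * (p + q).choose u ≤ (depShadow M p q u).card * (p + q).choose q

/-- The two parts together give the cumulative shadow inequality. -/
theorem shadowCumulative_of_split {p q : ℕ} (hi : IndepShadowCumulative M p q)
    (hd : DepShadowCumulative M p q) : ShadowCumulative M p q := by
  intro u hqu hup
  rw [card_shadowLev_eq_indep_add_dep, card_shadowLev_eq_indep_add_dep, add_mul, add_mul]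
  exact Nat.add_le_add (hi u hqu hup) (hd u hqu hup)

/-- On the tight layer, ultra-log-concavity of the independent shadow (with `i_u ≠ 0` on `[q, p]`) gives its
cumulative inequality. -/
theorem indepShadowCumulative_of_ulc {p q : ℕ} (hn : (gr M).card = p + q) (hr : M.eRank = (p : ℕ∞))
    (hqp : q ≤ p) (hpos : ∀ u, q ≤ u → u ≤ p → (indepShadow M p q u).card ≠ 0)
    (hulc : ∀ u, q < u → u < p →
      (indepShadow M p q (u - 1)).card * (indepShadow M p q (u + 1)).card * ((p + q).choose u) ^ 2
        ≤ (indepShadow M p q u).card * (indepShadow M p q u).card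
          * ((p + q).choose (u - 1) * (p + q).choose (u + 1))) :
    IndepShadowCumulative M p q :=
  fun u hqu hup => indepShadow_cumulative_of_ulc M hn hr hqp hpos hulc u hqu.le hup.le

end PercRepro.RankDist
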